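import Literature.Topology.FourManifolds.SimplifiedBrokenLefschetzSphereSideTube
import Literature.Topology.FourManifolds.TorusCoordinates
import HarnessLib

/-!
# Disc extension, layer 1: the height and the base coordinates along the torus side

Auxiliary file of helper `helper_sliceGluing_discExtension` (apex leaf DX: extension of the
torus angular coordinate over the torus disc), line `Sketch`, crux `SblfDescent.RungOne`.

(Crux item stmt-SmoothPoincare4-18531; skeleton `Cruxes/RungOne/Lines/Sketch.lean`.)

For a pole `v ∈ S²` with `v₀ = v₁ = 0` the torus side of the fibration is parametrised as a
product `ιT : Fb × ℝ² ↪ X` along which `f (ιT (θ, w)) = yT v w := σ_{-v}⁻¹ (univBall 0 2 w)`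
(`IsTorusSideProduct`).  This file is the planar bookkeeping of that parametrisation:

* the height `v₂ · (yT v w)₂ = sT w = 1 / (1 + 2‖w‖²)` (from
  `SphereSideTube.height_stereographic'_symm_univBall`), strictly decreasing in `‖w‖`, with the
  level radius `rad s = √((1/s - 1)/2)`;
* the longitude `uT v w ∈ 𝕊¹` of the base point `yT v w` (its first two coordinates normalised),
  so that `yT v w = (√(1 - sT²) uT, v₂ sT)` in coordinates, smooth along the circles
  `t ↦ R · circlePt t`.

Everything is folklore calculus.
-/

set_option linter.dupNamespace false

noncomputable section

open scoped Manifold ContDiff Topology Real RealInnerProductSpace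
open Set Function Metric Literature.Topology.FourManifolds

namespace Summit.SmoothPoincare4.SmoothPoincare4.Cruxes.RungOne.Sketch

namespace DiscExt

/-- Local notation: `𝔼 n` is the model Euclidean space `EuclideanSpace ℝ (Fin n)`. -/
local notation "𝔼 " n:arg => EuclideanSpace ℝ (Fin n)

/-- Local notation: `𝕊¹`, the unit circle of `ℝ²`. -/
local notation "𝕊¹" => (Metric.sphere (0 : EuclideanSpace ℝ (Fin 2)) (1 : ℝ))

/-- Local notation: `𝕊²`, the unit sphere of `ℝ³`. -/
local notation "𝕊²" => (Metric.sphere (0 : EuclideanSpace ℝ (Fin 3)) (1 : ℝ))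

attribute [local instance] Literature.Topology.FourManifolds.fact_finrank_euclideanSpace_succ

/-! ### Poles with `v₀ = v₁ = 0` -/

section Pole

variable {v : 𝕊²}

/-- A point of `S²` has coordinates with `y₀² + y₁² + y₂² = 1`. [folklore] -/
theorem sphere_coords_sq (y : 𝕊²) : (y : 𝔼 3) 0 ^ 2 + (y : 𝔼 3) 1 ^ 2 + (y : 𝔼 3) 2 ^ 2 = 1 := by
  have h : ‖(y : 𝔼 3)‖ ^ 2 = 1 := by rw [norm_eq_of_mem_sphere y, one_pow]
  rw [EuclideanSpace.norm_sq_eq, Fin.sum_univ_three] at h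
  simpa only [Real.norm_eq_abs, sq_abs] using h

/-- For a pole with `v₀ = v₁ = 0`: `v₂² = 1`. [folklore] -/
theorem pole_sq (hv0 : (v : 𝔼 3) 0 = 0) (hv1 : (v : 𝔼 3) 1 = 0) : (v : 𝔼 3) 2 ^ 2 = 1 := by
  have := sphere_coords_sq v
  rw [hv0, hv1] at this
  simpa using this

/-- For a pole with `v₀ = v₁ = 0`: `v₂ * v₂ = 1`. [folklore] -/
theorem pole_mul_self (hv0 : (v : 𝔼 3) 0 = 0) (hv1 : (v : 𝔼 3) 1 = 0) :
    (v : 𝔼 3) 2 * (v : 𝔼 3) 2 = 1 := by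
  rw [← sq]; exact pole_sq hv0 hv1

/-- For a pole with `v₀ = v₁ = 0`, the height `⟪y, v⟫` is `v₂ y₂`. [folklore] -/
theorem inner_pole (hv0 : (v : 𝔼 3) 0 = 0) (hv1 : (v : 𝔼 3) 1 = 0) (y : 𝔼 3) :
    ⟪y, (v : 𝔼 3)⟫ = (v : 𝔼 3) 2 * y 2 := by
  rw [PiLp.inner_apply, Fin.sum_univ_three]
  simp [hv0, hv1, mul_comm]

/-- The height `v₂ y₂` of a point of `S²` is at most `1` in absolute value. [folklore] -/
theorem abs_pole_height_le (hv0 : (v : 𝔼 3) 0 = 0) (hv1 : (v : 𝔼 3) 1 = 0) (y : 𝕊²) :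
    |(v : 𝔼 3) 2 * (y : 𝔼 3) 2| ≤ 1 := by
  rw [← inner_pole hv0 hv1]
  have h := abs_real_inner_le_norm (y : 𝔼 3) (v : 𝔼 3)
  rwa [norm_eq_of_mem_sphere y, norm_eq_of_mem_sphere v, one_mul] at h

end Pole

/-! ### The base point `yT v w` and its height `sT w` -/

/-- **The base point over `w`**: `yT v w = σ_{-v}⁻¹ (univBall 0 2 w)`, the right-hand side of
`IsTorusSideProduct.formula`. [folklore] -/
def yT (v : 𝕊²) (w : 𝔼 2) : 𝕊² :=
  (stereographic' 2 (-v)).symm (OpenPartialHomeomorph.univBall (0 : 𝔼 2) 2 w)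

/-- `yT v` is smooth (a chart inverse after the radial diffeomorphism `univBall`). [folklore] -/
theorem contMDiff_yT (v : 𝕊²) : ContMDiff 𝓘(ℝ, 𝔼 2) (𝓡 2) ∞ (yT v) := by
  have h := contMDiffOn_chart_symm (I := 𝓡 2) (n := ∞) (x := v) (H := 𝔼 2)
  rw [show (chartAt (𝔼 2) v) = stereographic' 2 (-v) from rfl, stereographic'_target] at h
  exact h.comp_contMDiff (OpenPartialHomeomorph.contDiff_univBall (n := ⊤)).contMDiff fun _ ↦ mem_univ _

/-- `yT v` is injective. [folklore] -/
theorem yT_injective (v : 𝕊²) : Injective (yT v) := by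
  intro w w' h
  have h1 : (stereographic' 2 (-v)).symm.toPartialEquiv.IsImage univ univ := by
    intro x _; simp
  have hinj : InjOn (stereographic' 2 (-v)).symm (stereographic' 2 (-v)).target :=
    (stereographic' 2 (-v)).symm.injOn
  rw [stereographic'_target] at hinj
  have h2 := hinj (mem_univ _) (mem_univ _) h
  have hinj2 : InjOn (OpenPartialHomeomorph.univBall (0 : 𝔼 2) 2)
      (OpenPartialHomeomorph.univBall (0 : 𝔼 2) 2).source := (OpenPartialHomeomorph.univBall (0 : 𝔼 2) 2).injOn
  rw [OpenPartialHomeomorph.univBall_source] at hinj2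
  exact hinj2 (mem_univ _) (mem_univ _) h2

/-- The coordinates of `yT v` are smooth functions of `w`. [folklore] -/
theorem contDiff_yT_apply (v : 𝕊²) (i : Fin 3) : ContDiff ℝ ∞ fun w ↦ ((yT v w : 𝕊²) : 𝔼 3) i := by
  have h1 : ContMDiff 𝓘(ℝ, 𝔼 2) 𝓘(ℝ, 𝔼 3) ∞ fun w ↦ ((yT v w : 𝕊²) : 𝔼 3) :=
    contMDiff_coe_sphere.comp (contMDiff_yT v)
  have h2 : ContDiff ℝ ∞ fun w ↦ ((yT v w : 𝕊²) : 𝔼 3) := contMDiff_iff_contDiff.1 h1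
  exact (EuclideanSpace.proj i).contDiff.comp h2

/-- **The height profile** `sT w = 1 / (1 + 2‖w‖²)`. [folklore] -/
def sT (w : 𝔼 2) : ℝ := (1 + 2 * ‖w‖ ^ 2)⁻¹

/-- `1 + 2‖w‖² > 0`. [folklore] -/
theorem one_add_two_mul_norm_sq_pos (w : 𝔼 2) : 0 < 1 + 2 * ‖w‖ ^ 2 := by positivity

/-- `0 < sT w`. [folklore] -/
theorem sT_pos (w : 𝔼 2) : 0 < sT w := inv_pos.2 (one_add_two_mul_norm_sq_pos w)

/-- `sT w ≤ 1`. [folklore] -/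
theorem sT_le_one (w : 𝔼 2) : sT w ≤ 1 :=
  inv_le_one_of_one_le₀ (by have := sq_nonneg ‖w‖; linarith)

/-- `sT w < 1` for `w ≠ 0`. [folklore] -/
theorem sT_lt_one {w : 𝔼 2} (hw : w ≠ 0) : sT w < 1 :=
  inv_lt_one_of_one_lt₀ (by have := norm_pos_iff.2 hw; nlinarith)

/-- `sT 0 = 1`. [folklore] -/
@[simp] theorem sT_zero : sT (0 : 𝔼 2) = 1 := by simp [sT]

/-- `sT` is smooth. [folklore] -/
theorem contDiff_sT : ContDiff ℝ ∞ sT := by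
  refine ContDiff.inv (contDiff_const.add (contDiff_const.mul (contDiff_norm_sq ℝ))) fun w ↦ ?_
  exact (one_add_two_mul_norm_sq_pos w).ne'

/-- `sT` is strictly decreasing in `‖w‖`. [folklore] -/
theorem sT_lt_sT {w w' : 𝔼 2} (h : ‖w‖ < ‖w'‖) : sT w' < sT w := by
  unfold sT
  have h1 : ‖w‖ ^ 2 < ‖w'‖ ^ 2 := by
    have := norm_nonneg w; nlinarith
  exact (inv_lt_inv₀ (one_add_two_mul_norm_sq_pos w') (one_add_two_mul_norm_sq_pos w)).2 (by linarith)

/-- `sT` is a function of `‖w‖`. [folklore] -/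
theorem sT_eq_sT_of_norm_eq {w w' : 𝔼 2} (h : ‖w‖ = ‖w'‖) : sT w = sT w' := by
  unfold sT; rw [h]

/-- `sT w < sT w' ↔ ‖w'‖ < ‖w‖`. [folklore] -/
theorem sT_lt_sT_iff {w w' : 𝔼 2} : sT w < sT w' ↔ ‖w'‖ < ‖w‖ := by
  constructor
  · intro h
    by_contra hle
    push Not at hle
    rcases hle.lt_or_eq with hlt | heq
    · exact (lt_asymm h) (sT_lt_sT hlt)
    · exact h.ne (sT_eq_sT_of_norm_eq heq)
  · exact sT_lt_sT

/-- On the circle of radius `R`: `sT (R • circlePt t) = 1 / (1 + 2R²)`. [folklore] -/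
theorem sT_smul_circlePt (R t : ℝ) : sT (R • ((circlePt t : 𝕊¹) : 𝔼 2)) = (1 + 2 * R ^ 2)⁻¹ := by
  rw [sT, norm_smul, norm_eq_of_mem_sphere (circlePt t), mul_one, Real.norm_eq_abs, sq_abs]

/-- **The level radius** `rad s = √((1/s - 1)/2)`: `sT w = s ↔ ‖w‖ = rad s` for `0 < s ≤ 1`.
[folklore] -/
def rad (s : ℝ) : ℝ := √((s⁻¹ - 1) / 2)

/-- `rad s > 0` for `0 < s < 1`. [folklore] -/
theorem rad_pos {s : ℝ} (hs : 0 < s) (hs1 : s < 1) : 0 < rad s :=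
  Real.sqrt_pos.2 (by have := one_lt_inv₀ hs |>.2 hs1; linarith)

/-- `1 + 2 (rad s)² = 1/s` for `0 < s ≤ 1`. [folklore] -/
theorem one_add_two_mul_rad_sq {s : ℝ} (hs : 0 < s) (hs1 : s ≤ 1) : 1 + 2 * rad s ^ 2 = s⁻¹ := by
  rw [rad, Real.sq_sqrt]
  · ring
  · have := one_le_inv₀ hs |>.2 hs1; linarith

/-- The height at radius `rad s` is `s`. [folklore] -/
theorem sT_of_norm_eq_rad {s : ℝ} (hs : 0 < s) (hs1 : s ≤ 1) {w : 𝔼 2} (h : ‖w‖ = rad s) :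
    sT w = s := by
  rw [sT, h, one_add_two_mul_rad_sq hs hs1, inv_inv]

/-- `sT (rad s • circlePt t) = s`. [folklore] -/
theorem sT_rad_smul_circlePt {s : ℝ} (hs : 0 < s) (hs1 : s ≤ 1) (t : ℝ) :
    sT (rad s • ((circlePt t : 𝕊¹) : 𝔼 2)) = s := by
  rw [sT_smul_circlePt, one_add_two_mul_rad_sq hs hs1, inv_inv]

/-- **Levels versus radii**: `s < sT w ↔ ‖w‖ < rad s` for `0 < s ≤ 1`. [folklore] -/
theorem lt_sT_iff {s : ℝ} (hs : 0 < s) (hs1 : s ≤ 1) (w : 𝔼 2) : s < sT w ↔ ‖w‖ < rad s := by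
  have hw' : ‖(rad s • ((circlePt 0 : 𝕊¹) : 𝔼 2))‖ = rad s := by
    rw [norm_smul, norm_eq_of_mem_sphere (circlePt 0), mul_one, Real.norm_eq_abs, abs_of_nonneg (show 0 ≤ rad _ from Real.sqrt_nonneg _)]
  have key := sT_rad_smul_circlePt hs hs1 0
  conv_lhs => rw [← key]
  rw [sT_lt_sT_iff, hw']

/-- **Levels versus radii**: `sT w < s ↔ rad s < ‖w‖` for `0 < s ≤ 1`. [folklore] -/
theorem sT_lt_iff {s : ℝ} (hs : 0 < s) (hs1 : s ≤ 1) (w : 𝔼 2) : sT w < s ↔ rad s < ‖w‖ := by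
  have hw' : ‖(rad s • ((circlePt 0 : 𝕊¹) : 𝔼 2))‖ = rad s := by
    rw [norm_smul, norm_eq_of_mem_sphere (circlePt 0), mul_one, Real.norm_eq_abs, abs_of_nonneg (show 0 ≤ rad _ from Real.sqrt_nonneg _)]
  have key := sT_rad_smul_circlePt hs hs1 0
  conv_lhs => rw [← key]
  rw [sT_lt_sT_iff, hw']

/-- `rad` is strictly decreasing on `(0, 1]`. [folklore] -/
theorem rad_lt_rad {s s' : ℝ} (hs : 0 < s) (hs'1 : s' ≤ 1) (h : s < s') : rad s' < rad s := by
  have hs' : 0 < s' := hs.trans h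
  have h1 : sT (rad s' • ((circlePt 0 : 𝕊¹) : 𝔼 2)) = s' := sT_rad_smul_circlePt hs' hs'1 0
  have h2 : s < sT (rad s' • ((circlePt 0 : 𝕊¹) : 𝔼 2)) := by rw [h1]; exact h
  rw [lt_sT_iff hs (h.le.trans hs'1), norm_smul, norm_eq_of_mem_sphere (circlePt 0), mul_one,
    Real.norm_eq_abs, abs_of_nonneg (show 0 ≤ rad _ from Real.sqrt_nonneg _)] at h2
  exact h2

section Pole

variable {v : 𝕊²}

/-- **The height along the torus side**: `v₂ (yT v w)₂ = 1 / (1 + 2‖w‖²)`. [folklore] -/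
theorem height_yT (hv0 : (v : 𝔼 3) 0 = 0) (hv1 : (v : 𝔼 3) 1 = 0) (w : 𝔼 2) :
    (v : 𝔼 3) 2 * ((yT v w : 𝕊²) : 𝔼 3) 2 = sT w := by
  have h : ⟪(((-v : 𝕊²) : 𝔼 3)), ((yT v w : 𝕊²) : 𝔼 3)⟫ = -(1 + 2 * ‖w‖ ^ 2)⁻¹ := by
    have h' := SphereSideTube.height_stereographic'_symm_univBall (-v) w
    rwa [SphereHeight.height_apply, SphereFourSplitting.sq2_eq_norm_sq] at h'
  have h2 : ⟪(((-v : 𝕊²) : 𝔼 3)), ((yT v w : 𝕊²) : 𝔼 3)⟫ = -((v : 𝔼 3) 2 * ((yT v w : 𝕊²) : 𝔼 3) 2) := by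
    rw [coe_neg_sphere, inner_neg_left, real_inner_comm, inner_pole hv0 hv1]
  rw [← neg_inj, ← h2, h, sT]

/-- The planar part of `yT v w` has squared norm `1 - sT²`. [folklore] -/
theorem yT_planar_sq (hv0 : (v : 𝔼 3) 0 = 0) (hv1 : (v : 𝔼 3) 1 = 0) (w : 𝔼 2) :
    ((yT v w : 𝕊²) : 𝔼 3) 0 ^ 2 + ((yT v w : 𝕊²) : 𝔼 3) 1 ^ 2 = 1 - sT w ^ 2 := by
  have h1 := sphere_coords_sq (yT v w)
  have h2 : ((yT v w : 𝕊²) : 𝔼 3) 2 ^ 2 = sT w ^ 2 := by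
    rw [← height_yT hv0 hv1 w, mul_pow, pole_sq hv0 hv1, one_mul]
  linarith

/-- The third coordinate of `yT v w` is `v₂ sT w`. [folklore] -/
theorem yT_apply_two (hv0 : (v : 𝔼 3) 0 = 0) (hv1 : (v : 𝔼 3) 1 = 0) (w : 𝔼 2) :
    ((yT v w : 𝕊²) : 𝔼 3) 2 = (v : 𝔼 3) 2 * sT w := by
  rw [← height_yT hv0 hv1 w, ← mul_assoc, pole_mul_self hv0 hv1, one_mul]

/-- `1 - sT² > 0` off the origin. [folklore] -/
theorem one_sub_sT_sq_pos {w : 𝔼 2} (hw : w ≠ 0) : 0 < 1 - sT w ^ 2 := by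
  have h1 := sT_lt_one hw
  have h2 := sT_pos w
  nlinarith

/-! ### The longitude `uT v w` -/

variable (v) in
/-- The normalised planar part of `yT v w` (a unit vector for `w ≠ 0`). [folklore] -/
def uvec (w : 𝔼 2) : 𝔼 2 :=
  (√(1 - sT w ^ 2))⁻¹ •
    (EuclideanSpace.equiv (Fin 2) ℝ).symm ![((yT v w : 𝕊²) : 𝔼 3) 0, ((yT v w : 𝕊²) : 𝔼 3) 1]

/-- First coordinate of `uvec`. [folklore] -/
theorem uvec_apply_zero (w : 𝔼 2) : uvec v w 0 = (√(1 - sT w ^ 2))⁻¹ * ((yT v w : 𝕊²) : 𝔼 3) 0 := by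
  simp [uvec]

/-- Second coordinate of `uvec`. [folklore] -/
theorem uvec_apply_one (w : 𝔼 2) : uvec v w 1 = (√(1 - sT w ^ 2))⁻¹ * ((yT v w : 𝕊²) : 𝔼 3) 1 := by
  simp [uvec]

/-- `uvec v w` is a unit vector for `w ≠ 0`. [folklore] -/
theorem norm_uvec (hv0 : (v : 𝔼 3) 0 = 0) (hv1 : (v : 𝔼 3) 1 = 0) {w : 𝔼 2} (hw : w ≠ 0) :
    ‖uvec v w‖ = 1 := by
  have hpos := one_sub_sT_sq_pos hw
  have hsq : ‖uvec v w‖ ^ 2 = 1 := by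
    rw [EuclideanSpace.norm_sq_eq, Fin.sum_univ_two]
    simp only [Real.norm_eq_abs, sq_abs]
    rw [uvec_apply_zero, uvec_apply_one, mul_pow, mul_pow, ← mul_add, yT_planar_sq hv0 hv1, inv_pow,
      Real.sq_sqrt hpos.le, inv_mul_cancel₀ hpos.ne']
  have h0 : 0 ≤ ‖uvec v w‖ := norm_nonneg _
  nlinarith [sq_nonneg (‖uvec v w‖ - 1)]

/-- `uvec v` is smooth off the origin. [folklore] -/
theorem contDiffAt_uvec {w : 𝔼 2} (hw : w ≠ 0) : ContDiffAt ℝ ∞ (uvec v) w := by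
  have h1 : ContDiffAt ℝ ∞ (fun w ↦ (√(1 - sT w ^ 2))⁻¹) w := by
    refine ContDiffAt.inv (ContDiffAt.sqrt (contDiffAt_const.sub (contDiff_sT.contDiffAt.pow 2))
      (one_sub_sT_sq_pos hw).ne') ?_
    exact (Real.sqrt_pos.2 (one_sub_sT_sq_pos hw)).ne'
  have h2 : ContDiff ℝ ∞ fun w ↦ (EuclideanSpace.equiv (Fin 2) ℝ).symm
      ![((yT v w : 𝕊²) : 𝔼 3) 0, ((yT v w : 𝕊²) : 𝔼 3) 1] := by
    refine (EuclideanSpace.equiv (Fin 2) ℝ).symm.contDiff.comp ?_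
    rw [contDiff_pi]
    intro i
    fin_cases i
    · exact contDiff_yT_apply v 0
    · exact contDiff_yT_apply v 1
  exact h1.smul h2.contDiffAt

variable (v) in
/-- **The longitude** `uT v w ∈ 𝕊¹` of the base point over `w` (for `w = 0` an arbitrary
point). [folklore] -/
def uT (w : 𝔼 2) : 𝕊¹ :=
  if h : ‖uvec v w‖ = 1 then ⟨uvec v w, mem_sphere_zero_iff_norm.2 h⟩ else ptA

/-- `uT v w` is `uvec v w` for `w ≠ 0`. [folklore] -/
theorem coe_uT (hv0 : (v : 𝔼 3) 0 = 0) (hv1 : (v : 𝔼 3) 1 = 0) {w : 𝔼 2} (hw : w ≠ 0) :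
    ((uT v w : 𝕊¹) : 𝔼 2) = uvec v w := by
  rw [uT, dif_pos (norm_uvec hv0 hv1 hw)]

/-- **The base point in longitude–height form**, first coordinate:
`(yT v w)₀ = √(1 - sT²) (uT v w)₀`. [folklore] -/
theorem yT_apply_zero (hv0 : (v : 𝔼 3) 0 = 0) (hv1 : (v : 𝔼 3) 1 = 0) {w : 𝔼 2} (hw : w ≠ 0) :
    ((yT v w : 𝕊²) : 𝔼 3) 0 = √(1 - sT w ^ 2) * ((uT v w : 𝕊¹) : 𝔼 2) 0 := by
  have hne : √(1 - sT w ^ 2) ≠ 0 := (Real.sqrt_pos.2 (one_sub_sT_sq_pos hw)).ne'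
  rw [coe_uT hv0 hv1 hw, uvec_apply_zero, ← mul_assoc, mul_inv_cancel₀ hne, one_mul]

/-- **The base point in longitude–height form**, second coordinate:
`(yT v w)₁ = √(1 - sT²) (uT v w)₁`. [folklore] -/
theorem yT_apply_one (hv0 : (v : 𝔼 3) 0 = 0) (hv1 : (v : 𝔼 3) 1 = 0) {w : 𝔼 2} (hw : w ≠ 0) :
    ((yT v w : 𝕊²) : 𝔼 3) 1 = √(1 - sT w ^ 2) * ((uT v w : 𝕊¹) : 𝔼 2) 1 := by
  have hne : √(1 - sT w ^ 2) ≠ 0 := (Real.sqrt_pos.2 (one_sub_sT_sq_pos hw)).ne'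
  rw [coe_uT hv0 hv1 hw, uvec_apply_one, ← mul_assoc, mul_inv_cancel₀ hne, one_mul]

/-- A point of `S²` with the coordinates of `yT v w` is `yT v w`. [folklore] -/
theorem eq_yT_of_coords (hv0 : (v : 𝔼 3) 0 = 0) (hv1 : (v : 𝔼 3) 1 = 0) {w : 𝔼 2} (hw : w ≠ 0)
    {y : 𝕊²} (h0 : (y : 𝔼 3) 0 = √(1 - sT w ^ 2) * ((uT v w : 𝕊¹) : 𝔼 2) 0)
    (h1 : (y : 𝔼 3) 1 = √(1 - sT w ^ 2) * ((uT v w : 𝕊¹) : 𝔼 2) 1)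
    (h2 : (y : 𝔼 3) 2 = (v : 𝔼 3) 2 * sT w) : y = yT v w := by
  apply Subtype.ext
  ext i
  fin_cases i
  · exact h0.trans (yT_apply_zero hv0 hv1 hw).symm
  · exact h1.trans (yT_apply_one hv0 hv1 hw).symm
  · exact h2.trans (yT_apply_two hv0 hv1 w).symm

/-- A longitude `u` with `√(1 - sT²) u = ((yT v w)₀, (yT v w)₁)` is `uT v w`. [folklore] -/
theorem eq_uT_of_coords (hv0 : (v : 𝔼 3) 0 = 0) (hv1 : (v : 𝔼 3) 1 = 0) {w : 𝔼 2} (hw : w ≠ 0)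
    {u : 𝕊¹} (h0 : √(1 - sT w ^ 2) * (u : 𝔼 2) 0 = ((yT v w : 𝕊²) : 𝔼 3) 0)
    (h1 : √(1 - sT w ^ 2) * (u : 𝔼 2) 1 = ((yT v w : 𝕊²) : 𝔼 3) 1) : u = uT v w := by
  have hne : √(1 - sT w ^ 2) ≠ 0 := (Real.sqrt_pos.2 (one_sub_sT_sq_pos hw)).ne'
  apply Subtype.ext
  ext i
  fin_cases i
  · exact mul_left_cancel₀ hne (h0.trans (yT_apply_zero hv0 hv1 hw))
  · exact mul_left_cancel₀ hne (h1.trans (yT_apply_one hv0 hv1 hw))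

/-- **The longitude is smooth along circles**: `t ↦ uT v (R • circlePt t)` is `C^∞` for
`R > 0`. [folklore] -/
theorem contMDiff_uT_circle (hv0 : (v : 𝔼 3) 0 = 0) (hv1 : (v : 𝔼 3) 1 = 0) {R : ℝ} (hR : 0 < R) :
    ContMDiff 𝓘(ℝ, ℝ) (𝓡 1) ∞ fun t ↦ uT v (R • ((circlePt t : 𝕊¹) : 𝔼 2)) := by
  have hne : ∀ t, R • ((circlePt t : 𝕊¹) : 𝔼 2) ≠ 0 := fun t ↦ by
    rw [← norm_ne_zero_iff, norm_smul, norm_eq_of_mem_sphere (circlePt t), mul_one, Real.norm_eq_abs,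
      abs_of_pos hR]
    exact hR.ne'
  have hc : ContDiff ℝ ∞ fun t : ℝ ↦ R • ((circlePt t : 𝕊¹) : 𝔼 2) := by
    have h1 : ContMDiff 𝓘(ℝ, ℝ) 𝓘(ℝ, 𝔼 2) ∞ fun t : ℝ ↦ ((circlePt t : 𝕊¹) : 𝔼 2) :=
      contMDiff_coe_sphere.comp contMDiff_circlePt
    exact (contDiff_const (c := R)).smul (contMDiff_iff_contDiff.1 h1)
  have hs : ContDiff ℝ ∞ fun t : ℝ ↦ uvec v (R • ((circlePt t : 𝕊¹) : 𝔼 2)) :=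
    contDiff_iff_contDiffAt.2 fun t ↦
      ContDiffAt.comp (g := uvec v) (f := fun t : ℝ ↦ R • ((circlePt t : 𝕊¹) : 𝔼 2)) t
        (contDiffAt_uvec (hne t)) hc.contDiffAt
  have hmem : ∀ t, uvec v (R • ((circlePt t : 𝕊¹) : 𝔼 2)) ∈ Metric.sphere (0 : 𝔼 2) 1 := fun t ↦
    mem_sphere_zero_iff_norm.2 (norm_uvec hv0 hv1 (hne t))
  have heq : (fun t ↦ uT v (R • ((circlePt t : 𝕊¹) : 𝔼 2))) = Set.codRestrict _ _ hmem := by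
    funext t
    apply Subtype.ext
    rw [coe_uT hv0 hv1 (hne t), val_codRestrict_apply]
  rw [heq]
  exact hs.contMDiff.codRestrict_sphere _

end Pole

end DiscExt

end Summit.SmoothPoincare4.SmoothPoincare4.Cruxes.RungOne.Sketch

end
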